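import Mathlib
import HarnessLib
import Literature.Analysis.FluidPDE.ZerothLaw
import Literature.Analysis.FunctionSpaces.TorusSpaceTime
import Summits.AnomalousDissipation.AnomalousDissipation.Theorems.ImpulseGridBoundedEnergyGridStubAxisZeroOfAxisTwo

/-!
# Stub `stub_forwardAxisZeroOfAxisTwo` of the line `Sketch` (crux stmt-AnomalousDissipation-10430,
# `ImpulseGrid.BoundedEnergyGrid`): columnar forward family, axis `2` ⇒ axis `0`

Registered signature (proved here verbatim; `𝕋³ = UnitAddTorus (Fin 3)`,
`E³ = EuclideanSpace ℝ (Fin 3)` are the skeleton's local notations, redeclared below with the same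
meaning):
```
theorem stub_forwardAxisZeroOfAxisTwo :
    (∃ G : 𝕋³ → E³, IsSmooth G ∧ (∀ (s : UnitAddCircle) x, G (x + Pi.single (2 : Fin 3) s) = G x) ∧
      (∀ x, G x 2 = 0) ∧ IsDivFree G ∧ HasZeroMean G ∧ G ≠ 0 ∧
      ∃ (ν : ℕ → ℝ) (V : ℕ → ℝ → 𝕋³ → E³) (q : ℕ → ℝ → 𝕋³ → ℝ),
        (∀ j, 0 < ν j) ∧ Tendsto ν atTop (𝓝 0) ∧
        (∀ j, IsClassicalNSSolutionOn (Ici 0) (ν j) (fun _ => G) (V j) (q j)) ∧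
        (∀ j t (s : UnitAddCircle) x, V j t (x + Pi.single (2 : Fin 3) s) = V j t x) ∧
        (∀ j t x, V j t x 2 = 0) ∧ (∀ j, HasZeroMean (V j 0)) ∧
        (∀ j, ∃ C : ℝ, ∀ t, 0 ≤ t → ∫ x, ‖V j t x‖ ^ 2 ≤ C) ∧
        ∃ E : ℝ, ∀ j, meanEnergy (V j) ≤ E) →
    ∃ G : 𝕋³ → E³, IsSmooth G ∧ (∀ (s : UnitAddCircle) x, G (x + Pi.single (0 : Fin 3) s) = G x) ∧
      (∀ x, G x 0 = 0) ∧ IsDivFree G ∧ HasZeroMean G ∧ G ≠ 0 ∧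
      ∃ (ν : ℕ → ℝ) (V : ℕ → ℝ → 𝕋³ → E³) (q : ℕ → ℝ → 𝕋³ → ℝ),
        (∀ j, 0 < ν j) ∧ Tendsto ν atTop (𝓝 0) ∧
        (∀ j, IsClassicalNSSolutionOn (Ici 0) (ν j) (fun _ => G) (V j) (q j)) ∧
        (∀ j t (s : UnitAddCircle) x, V j t (x + Pi.single (0 : Fin 3) s) = V j t x) ∧
        (∀ j t x, V j t x 0 = 0) ∧ (∀ j, HasZeroMean (V j 0)) ∧
        (∀ j, ∃ C : ℝ, ∀ t, 0 ≤ t → ∫ x, ‖V j t x‖ ^ 2 ≤ C) ∧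
        ∃ E : ℝ, ∀ j, meanEnergy (V j) ≤ E
```

The step is pure symmetry, the time-dependent analogue of the landed steady step
`stub_axisZeroOfAxisTwo` (whose `*_conj_swap` kit is imported and reused): the forced
incompressible Navier–Stokes system on `T³ × S` (any time set `S`, here `S = Ici 0`) is equivariant
under the coordinate swap `σ = Equiv.swap (0 : Fin 3) 2`. With `P x := x ∘ σ` on `T³` (written
inline as `fun k => x (σ k)`) and the linear isometry
`A := LinearIsometryEquiv.piLpCongrLeft 2 ℝ ℝ σ` of `ℝ³`, a classical solution `(f, V, q)` on `S` is
carried to the conjugated classical solution `(A ∘ f(t) ∘ P, A ∘ V(t) ∘ P, q(t) ∘ P)`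
(`isClassicalNSSolutionOn_conj_swap`). Slice-wise the spatial operators commute with the
conjugation by the kit (`divergence_conj_swap`, `convect_conj_swap`, `laplacian_conj_swap`,
`gradient_comp_swap`); the two new ingredients are

* joint smoothness: `stLift (V(·) ∘ P) = stLift V ∘ (id × A)` definitionally (`stLift_comp_swap`),
  so `ContDiffOn` on `S ×ˢ univ` is transported by composition with a linear map;
* the one-sided time derivative commutes with the linear isometry `A` with no differentiability
  hypothesis (`forwardSwap_derivWithin_comp`: at points of unique differentiability this is
  `LinearIsometryEquiv.comp_fderivWithin`, elsewhere both sides vanish by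
  `derivWithin_zero_of_not_uniqueDiffWithinAt`), whence `timeDerivWithin_conj_swap`.

Slice energies are preserved for every `t` (`integral_norm_sq_conj_swap`, hypothesis-free), so the
per-`j` sup bound transfers with the same constant and the mean energies coincide
(`meanEnergy_conj_swap`); invariance along axis `0`, the vanishing component `0`, zero mean at
`t = 0` and `G ≠ 0` are verbatim from the steady step. Pure proof file (no definitions): the
conjugated fields are written inline.
-/

-- `Summit.<Summit>.<Problem>` is the tree's mandated summit-side namespace (CONVENTIONS §2); for
-- this single-conjunct summit the two coincide, so the duplicate is deliberate.
set_option linter.dupNamespace false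

noncomputable section

open MeasureTheory Filter Topology Set
open Literature.Analysis.FunctionSpaces Literature.Analysis.FunctionSpaces.Torus
open Literature.Analysis.FluidPDE Literature.Analysis.FluidPDE.Torus

namespace Summit.AnomalousDissipation.AnomalousDissipation.Theorems

/-- The flat three-torus (local notation, as in the registered skeleton). -/
local notation "𝕋³" => UnitAddTorus (Fin 3)
/-- Velocity values on `T³` (local notation, as in the registered skeleton). -/
local notation "E³" => EuclideanSpace ℝ (Fin 3)

/-- A linear isometric isomorphism commutes with the one-sided derivative `derivWithin`, with no
differentiability or unique-differentiability hypothesis (where unique differentiability fails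
both sides are the junk value `0`). [folklore] -/
theorem forwardSwap_derivWithin_comp {F F' : Type*} [NormedAddCommGroup F] [NormedSpace ℝ F]
    [NormedAddCommGroup F'] [NormedSpace ℝ F'] (L : F ≃ₗᵢ[ℝ] F') (g : ℝ → F) (s : Set ℝ) (t : ℝ) :
    derivWithin (fun τ => L (g τ)) s t = L (derivWithin g s t) := by
  by_cases ht : UniqueDiffWithinAt ℝ s t
  · rw [← fderivWithin_derivWithin, ← fderivWithin_derivWithin,
      show (fun τ => L (g τ)) = ⇑L ∘ g from rfl, L.comp_fderivWithin ht]
    rfl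
  · rw [derivWithin_zero_of_not_uniqueDiffWithinAt ht,
      derivWithin_zero_of_not_uniqueDiffWithinAt ht, map_zero]

/-- `stLift (V(·) ∘ P) = stLift V ∘ (id × A)` (definitionally). [folklore] -/
theorem stLift_comp_swap {F : Type*} (V : ℝ → UnitAddTorus (Fin 3) → F) :
    stLift (fun t (x : UnitAddTorus (Fin 3)) => V t (fun i => x (Equiv.swap (0 : Fin 3) 2 i))) =
      stLift V ∘ fun p : ℝ × EuclideanSpace ℝ (Fin 3) =>
        (p.1, LinearIsometryEquiv.piLpCongrLeft 2 ℝ ℝ (Equiv.swap (0 : Fin 3) 2) p.2) :=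
  rfl

/-- Jointly smooth fields stay jointly smooth after precomposition with `P` in space.
[folklore] -/
theorem isSmoothSpaceTimeOn_comp_swap {F : Type*} [NormedAddCommGroup F] [NormedSpace ℝ F]
    {S : Set ℝ} {V : ℝ → UnitAddTorus (Fin 3) → F} (hV : Torus.IsSmoothSpaceTimeOn S V) :
    Torus.IsSmoothSpaceTimeOn S
      (fun t (x : UnitAddTorus (Fin 3)) => V t (fun i => x (Equiv.swap (0 : Fin 3) 2 i))) := by
  unfold Torus.IsSmoothSpaceTimeOn
  rw [stLift_comp_swap]
  refine hV.comp ?_ fun p hp => mk_mem_prod (mem_prod.1 hp).1 (mem_univ _)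
  exact (contDiff_fst.prodMk ((LinearIsometryEquiv.piLpCongrLeft 2 ℝ ℝ
    (Equiv.swap (0 : Fin 3) 2)).contDiff.comp contDiff_snd)).contDiffOn

/-- Jointly smooth vector fields stay jointly smooth after conjugation `V(t) ↦ A ∘ V(t) ∘ P`.
[folklore] -/
theorem isSmoothSpaceTimeOn_conj_swap {S : Set ℝ}
    {V : ℝ → UnitAddTorus (Fin 3) → EuclideanSpace ℝ (Fin 3)} (hV : Torus.IsSmoothSpaceTimeOn S V) :
    Torus.IsSmoothSpaceTimeOn S (fun t (x : UnitAddTorus (Fin 3)) =>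
      LinearIsometryEquiv.piLpCongrLeft 2 ℝ ℝ (Equiv.swap (0 : Fin 3) 2)
        (V t (fun i => x (Equiv.swap (0 : Fin 3) 2 i)))) :=
  (LinearIsometryEquiv.piLpCongrLeft 2 ℝ ℝ (Equiv.swap (0 : Fin 3) 2)).contDiff.comp_contDiffOn
    (isSmoothSpaceTimeOn_comp_swap hV)

/-- **The one-sided time derivative of conjugated fields**:
`∂ₜ|_S (A ∘ V(·) ∘ P) (t, x) = A (∂ₜ|_S V (t, P x))`, with no hypothesis. [folklore] -/
theorem timeDerivWithin_conj_swap (S : Set ℝ)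
    (V : ℝ → UnitAddTorus (Fin 3) → EuclideanSpace ℝ (Fin 3)) (t : ℝ) (x : UnitAddTorus (Fin 3)) :
    Torus.timeDerivWithin S (fun τ (y : UnitAddTorus (Fin 3)) =>
        LinearIsometryEquiv.piLpCongrLeft 2 ℝ ℝ (Equiv.swap (0 : Fin 3) 2)
          (V τ (fun i => y (Equiv.swap (0 : Fin 3) 2 i)))) t x =
      LinearIsometryEquiv.piLpCongrLeft 2 ℝ ℝ (Equiv.swap (0 : Fin 3) 2)
        (Torus.timeDerivWithin S V t (fun i => x (Equiv.swap (0 : Fin 3) 2 i))) :=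
  forwardSwap_derivWithin_comp _ _ S t

/-- **Equivariance of classical Navier–Stokes solutions under the swap**: if `V` is a classical
solution of `NS_ν(f)` on the time set `S` with pressure `q`, then `A ∘ V(t) ∘ P` is a classical
solution of `NS_ν(A ∘ f(t) ∘ P)` on `S` with pressure `q(t) ∘ P`. [folklore] -/
theorem isClassicalNSSolutionOn_conj_swap {S : Set ℝ} {ν : ℝ}
    {f V : ℝ → UnitAddTorus (Fin 3) → EuclideanSpace ℝ (Fin 3)} {q : ℝ → UnitAddTorus (Fin 3) → ℝ}
    (h : IsClassicalNSSolutionOn S ν f V q) :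
    IsClassicalNSSolutionOn S ν
      (fun t (x : UnitAddTorus (Fin 3)) =>
        LinearIsometryEquiv.piLpCongrLeft 2 ℝ ℝ (Equiv.swap (0 : Fin 3) 2)
          (f t (fun k => x (Equiv.swap (0 : Fin 3) 2 k))))
      (fun t (x : UnitAddTorus (Fin 3)) =>
        LinearIsometryEquiv.piLpCongrLeft 2 ℝ ℝ (Equiv.swap (0 : Fin 3) 2)
          (V t (fun k => x (Equiv.swap (0 : Fin 3) 2 k))))
      (fun t (x : UnitAddTorus (Fin 3)) => q t (fun k => x (Equiv.swap (0 : Fin 3) 2 k))) := by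
  refine ⟨isSmoothSpaceTimeOn_conj_swap h.smooth_velocity,
    isSmoothSpaceTimeOn_comp_swap h.smooth_pressure, fun t ht x => ?_,
    fun t ht x => (divergence_conj_swap (V t) x).trans (h.divFree t ht _)⟩
  have hV : IsSmooth (V t) := h.smooth_velocity.isSmooth_slice ht
  have hq : IsSmooth (q t) := h.smooth_pressure.isSmooth_slice ht
  have hm := h.momentum t ht (fun k => x (Equiv.swap (0 : Fin 3) 2 k))
  rw [timeDerivWithin_conj_swap, convect_conj_swap (hV.isContDiff (by simp)) x,
    laplacian_conj_swap hV x, gradient_comp_swap (hq.isContDiff (by simp)) x, ← map_add, hm,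
    map_add, map_sub, LinearIsometryEquiv.map_smul]

/-- The conjugation preserves the mean energy (slice energies agree for every `t`,
`integral_norm_sq_conj_swap`). [folklore] -/
theorem meanEnergy_conj_swap (V : ℝ → UnitAddTorus (Fin 3) → EuclideanSpace ℝ (Fin 3)) :
    meanEnergy (fun t (x : UnitAddTorus (Fin 3)) =>
        LinearIsometryEquiv.piLpCongrLeft 2 ℝ ℝ (Equiv.swap (0 : Fin 3) 2)
          (V t (fun i => x (Equiv.swap (0 : Fin 3) 2 i)))) = meanEnergy V := by
  rw [meanEnergy_eq_longTimeAvgSup, meanEnergy_eq_longTimeAvgSup]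
  exact congrArg longTimeAvgSup (funext fun t => integral_norm_sq_conj_swap (V t))

/-- **The registered stub `stub_forwardAxisZeroOfAxisTwo`**: a columnar forward classical family
on `T³` with invariant axis `2` (force `G`, solutions `V_j` on `[0, ∞)`, pressures `q_j`,
viscosities `ν_j → 0⁺`, per-`j` bounded slice energy, mean energies `≤ E`) yields one with
invariant axis `0`, namely the conjugated family `(A ∘ G ∘ P, A ∘ V_j(t) ∘ P, q_j(t) ∘ P)` under the
coordinate swap `σ = (0 2)` (`P x = x ∘ σ`, `(A w) i = w (σ i)`), with the same `ν_j`, the same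
per-`j` constants and the same `E`. [folklore] -/
theorem stub_forwardAxisZeroOfAxisTwo :
    (∃ G : 𝕋³ → E³, IsSmooth G ∧ (∀ (s : UnitAddCircle) x, G (x + Pi.single (2 : Fin 3) s) = G x) ∧
      (∀ x, G x 2 = 0) ∧ IsDivFree G ∧ HasZeroMean G ∧ G ≠ 0 ∧
      ∃ (ν : ℕ → ℝ) (V : ℕ → ℝ → 𝕋³ → E³) (q : ℕ → ℝ → 𝕋³ → ℝ),
        (∀ j, 0 < ν j) ∧ Tendsto ν atTop (𝓝 0) ∧
        (∀ j, IsClassicalNSSolutionOn (Ici 0) (ν j) (fun _ => G) (V j) (q j)) ∧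
        (∀ j t (s : UnitAddCircle) x, V j t (x + Pi.single (2 : Fin 3) s) = V j t x) ∧
        (∀ j t x, V j t x 2 = 0) ∧ (∀ j, HasZeroMean (V j 0)) ∧
        (∀ j, ∃ C : ℝ, ∀ t, 0 ≤ t → ∫ x, ‖V j t x‖ ^ 2 ≤ C) ∧
        ∃ E : ℝ, ∀ j, meanEnergy (V j) ≤ E) →
    ∃ G : 𝕋³ → E³, IsSmooth G ∧ (∀ (s : UnitAddCircle) x, G (x + Pi.single (0 : Fin 3) s) = G x) ∧
      (∀ x, G x 0 = 0) ∧ IsDivFree G ∧ HasZeroMean G ∧ G ≠ 0 ∧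
      ∃ (ν : ℕ → ℝ) (V : ℕ → ℝ → 𝕋³ → E³) (q : ℕ → ℝ → 𝕋³ → ℝ),
        (∀ j, 0 < ν j) ∧ Tendsto ν atTop (𝓝 0) ∧
        (∀ j, IsClassicalNSSolutionOn (Ici 0) (ν j) (fun _ => G) (V j) (q j)) ∧
        (∀ j t (s : UnitAddCircle) x, V j t (x + Pi.single (0 : Fin 3) s) = V j t x) ∧
        (∀ j t x, V j t x 0 = 0) ∧ (∀ j, HasZeroMean (V j 0)) ∧
        (∀ j, ∃ C : ℝ, ∀ t, 0 ≤ t → ∫ x, ‖V j t x‖ ^ 2 ≤ C) ∧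
        ∃ E : ℝ, ∀ j, meanEnergy (V j) ≤ E := by
  rintro ⟨G, hG, hGinv, hG2, hGdiv, hGmean, hGne, ν, V, q, hν, hν0, hcl, hVinv, hV2, hVmean,
    hbd, E, hE⟩
  refine ⟨fun x : UnitAddTorus (Fin 3) =>
      LinearIsometryEquiv.piLpCongrLeft 2 ℝ ℝ (Equiv.swap (0 : Fin 3) 2)
        (G (fun k => x (Equiv.swap (0 : Fin 3) 2 k))),
    isContDiff_conj_swap hG, fun s x => congrArg _ (comp_swap_add_single_zero G hGinv s x),
    fun x => ?_, fun x => (divergence_conj_swap G x).trans (hGdiv _),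
    hasZeroMean_conj_swap hGmean, fun h0 => hGne ?_, ν,
    fun j t x => LinearIsometryEquiv.piLpCongrLeft 2 ℝ ℝ (Equiv.swap (0 : Fin 3) 2)
      (V j t (fun k => x (Equiv.swap (0 : Fin 3) 2 k))),
    fun j t x => q j t (fun k => x (Equiv.swap (0 : Fin 3) 2 k)), hν, hν0,
    fun j => isClassicalNSSolutionOn_conj_swap (hcl j),
    fun j t s x => congrArg _ (comp_swap_add_single_zero (V j t) (hVinv j t) s x),
    fun j t x => ?_, fun j => hasZeroMean_conj_swap (hVmean j), fun j => ?_, E, fun j => ?_⟩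
  · -- vanishing component `0` of the force: `(A w) 0 = w 2`
    simp only [LinearIsometryEquiv.piLpCongrLeft_apply, Equiv.piCongrLeft'_apply, Equiv.symm_swap,
      Equiv.swap_apply_left, hG2]
  · -- the force is nonzero
    funext y
    have h1 := congrFun h0 (fun i => y (Equiv.swap (0 : Fin 3) 2 i))
    simp only [swap_swap_coord, Pi.zero_apply] at h1
    have h2 := congrArg (LinearIsometryEquiv.piLpCongrLeft 2 ℝ ℝ (Equiv.swap (0 : Fin 3) 2)) h1
    rw [piLpCongrLeft_swap_swap, map_zero] at h2
    exact h2
  · -- vanishing component `0` of the velocities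
    simp only [LinearIsometryEquiv.piLpCongrLeft_apply, Equiv.piCongrLeft'_apply, Equiv.symm_swap,
      Equiv.swap_apply_left, hV2]
  · -- the per-`j` sup-in-time bound on slice energies (same constant)
    obtain ⟨C, hC⟩ := hbd j
    exact ⟨C, fun t ht => (integral_norm_sq_conj_swap (V j t)).trans_le (hC t ht)⟩
  · -- the mean-energy bound (same `E`)
    exact (meanEnergy_conj_swap (V j)).trans_le (hE j)

end Summit.AnomalousDissipation.AnomalousDissipation.Theorems

end
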